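import Literature.NumberTheory.Transcendental.KZFibredRelations
import Literature.NumberTheory.Transcendental.KZDominatedFamily
import Summits.KontsevichZagierPeriods.KontsevichZagierPeriods.Theses.ValuedFieldSpecialisation

/-!
# Route ValuedFieldSpecialisation — crux `ParametricLifting` (stmt-KontsevichZagierPeriods-3498):
tightness (c), Newton–Leibniz over a point base is not a fibred move for a reason

Helper (`--supports`) for item stmt-KontsevichZagierPeriods-3498 (line `registered`, lead c5). The
crux `ParametricLifting` asks for FIBRED relations `G ∈ KZ.fibredRelations =
AddSubgroup.closure KZ.fibredGenerators`, whose Newton–Leibniz generators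
(`KZ.fibredNewtonLeibnizRel`) are the moves `[r] − [r']` of `KZ.newtonLeibnizRel` with
`r : IntegralRep (n + 2)` a band over a base `r' : IntegralRep (n + 1)` of dimension `≥ 1`, so that
the parameter coordinate `z 0` is a base coordinate. Its complement SF ("special fibres of dominated
fibred relations are relations") says: if `Σ mᵢ [Rᵢ]` is such a relation and every `Rᵢ` is a
dominated family (`KZ.IsDominatedFamily (R i) (r₀ i) (g i)`), then `Σ mᵢ [r₀ᵢ] ∈ KZ.relations`.

This file certifies that the restriction "base of dimension `≥ 1`" is load-bearing:
`not_specialFibre_newtonLeibniz_pointBase` — if the Newton–Leibniz moves over the POINT base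
(`r : IntegralRep 1` a band over `r' : IntegralRep 0`) are added to the fibred generators, SF fails.

Witness. The bands `R₁ = [[0, 1], 1]` and `R₂ = [[0, 1], 2t]` over the point `b₀ = [pt, 1]`
(bounds `a = 0`, `b = 1`, primitives `t` and `t ^ 2`, so `b₀`'s integrand is `F 1 − F 0 = 1` in both
cases) give `[R₁] − [b₀]`, `[R₂] − [b₀]` in the added set, hence `G = [R₁] − [R₂]` in the closure.
Read as families over `s = z 0` with `0`-dimensional fibres, `R₁` is dominated by `b₀` with special
fibre `b₀` (integrand `1 → 1`) and `R₂` by `[pt, 2]` with special fibre `[pt, 0]` (integrand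
`2s → 0`); the special-fibre class `[b₀] − [pt, 0]` evaluates to `1 ≠ 0`, so it is not a relation
(soundness of the calculus, `KZ.relations_le_ker_eval_holds`).

Contents (all proved, no definitions; representations are produced by `∃`-lemmas):
* `pointBase_exists_constRep` — the constants `[pt, q]`, `q ∈ ℚ`, of value `q`;
* `pointBase_band_eq_Icc`, `pointBase_exists_bandRep` — bands `[[0, 1], f]` with a polynomial
  integrand;
* `pointBase_sub_mem_newtonLeibnizRel` — Newton–Leibniz over the point base for a polynomial
  primitive; `pointBase_isDominatedFamily` — domination of a band read over `s = z 0`;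
* `not_specialFibre_newtonLeibniz_pointBase` — the tightness statement.

Sources: M. Kontsevich, D. Zagier, *Periods* (2001), §1.2, rule (3); the fibred/dominated
vocabulary is this route's (`KZFibredRelations.lean`, `KZDominatedFamily.lean`). Deliberately NOT
here: the companion tightness statements for the fibred change of variables and for the domination
clause (sibling `…Tightness*.lean` files of this crux).
-/

noncomputable section

namespace Summit.KontsevichZagierPeriods.ValuedFieldSpecialisation

open MeasureTheory Set Filter MvPolynomial
open scoped Topology
open Literature.NumberTheory.Transcendental Literature.NumberTheory.Transcendental.KZ
open Literature.ModelTheory.ExponentialFields (IsSemialgebraic)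

/-! ### Constants: `0`-dimensional representations -/

/-- **The constant representation `[pt, q]`** for a rational `q`: domain the point `ℝ⁰` (of
Lebesgue measure `1`, the empty product), integrand the constant `q` (a polynomial, hence
`ℚ`-semialgebraic), value `q`. [Kontsevich–Zagier 2001, §1.1] [folklore] -/
theorem pointBase_exists_constRep (q : ℚ) :
    ∃ r : IntegralRep 0, r.domain = univ ∧ (∀ x, r.integrand x = (q : ℝ)) ∧ r.value = (q : ℝ) := by
  have hvol : volume (univ : Set (Fin 0 → ℝ)) = 1 := by
    rw [volume_pi, Measure.pi_univ]
    simp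
  refine ⟨{ domain := univ
            integrand := fun _ => (q : ℝ)
            isSemialgebraic_domain :=
              Literature.ModelTheory.ExponentialFields.isSemialgebraic_univ
            isSemialgebraicFunOn_integrand := by
              simpa using isSemialgebraicFunOn_aeval
                (Literature.ModelTheory.ExponentialFields.isSemialgebraic_univ
                  (k := ℚ) (ι := Fin 0) (R := ℝ)) (C q : MvPolynomial (Fin 0) ℚ)
            integrableOn := integrableOn_const (hs := by simp [hvol]) },
    rfl, fun _ => rfl, ?_⟩
  simp [IntegralRep.value, Measure.restrict_univ, measureReal_def, hvol]

/-! ### Bands over the point -/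

/-- The band `{z : ℝ¹ | 0 ≤ z 0 ≤ 1}` is the order interval `[0, 1]` of `ℝ¹`. [folklore] -/
theorem pointBase_band_eq_Icc : {z : Fin 1 → ℝ | 0 ≤ z 0 ∧ z 0 ≤ 1} = Icc 0 1 := by
  ext z
  simp only [mem_setOf_eq, mem_Icc, Pi.le_def, Fin.forall_fin_one, Pi.zero_apply, Pi.one_apply]

/-- **Band representations `[[0, 1], f]`**: a continuous integrand `f` on `ℝ¹` given by a polynomial
with rational coefficients yields an integral representation on the band `{0 ≤ z 0 ≤ 1}` (two
polynomial inequalities, so `ℚ`-semialgebraic; semialgebraic graph; absolutely integrable as a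
continuous function on a compact set). [Kontsevich–Zagier 2001, §1.1] [folklore] -/
theorem pointBase_exists_bandRep {f : (Fin 1 → ℝ) → ℝ} (hf : Continuous f)
    (p : MvPolynomial (Fin 1) ℚ) (hp : ∀ z, aeval z p = f z) :
    ∃ r : IntegralRep 1, r.domain = {z : Fin 1 → ℝ | 0 ≤ z 0 ∧ z 0 ≤ 1} ∧ r.integrand = f := by
  have hband : IsSemialgebraic ℚ {z : Fin 1 → ℝ | 0 ≤ z 0 ∧ z 0 ≤ 1} := by
    have h1 := Literature.ModelTheory.ExponentialFields.isSemialgebraic_setOf_eval_le (k := ℚ)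
      (R := ℝ) (0 : MvPolynomial (Fin 1) ℚ) (X 0)
    have h2 := Literature.ModelTheory.ExponentialFields.isSemialgebraic_setOf_eval_le (k := ℚ)
      (R := ℝ) (X 0 : MvPolynomial (Fin 1) ℚ) 1
    simp only [map_zero, aeval_X, map_one] at h1 h2
    exact h1.inter h2
  exact ⟨{ domain := {z : Fin 1 → ℝ | 0 ≤ z 0 ∧ z 0 ≤ 1}
           integrand := f
           isSemialgebraic_domain := hband
           isSemialgebraicFunOn_integrand :=
             (isSemialgebraicFunOn_aeval hband p).congr fun z _ => hp z
           integrableOn := by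
             rw [pointBase_band_eq_Icc]
             exact hf.continuousOn.integrableOn_compact isCompact_Icc }, rfl, rfl⟩

/-! ### Newton–Leibniz over the point base, and domination of bands -/

/-- **Newton–Leibniz over the point base** (the move `KZ.newtonLeibnizRel` with `n = 0`): if
`r = [[0, 1], f]` is a band over the point with integrand `f (z 0)`, `b = [pt, F 1 − F 0]`, and
`F` is a continuous primitive of `f` (`F' = f`) which is a polynomial with rational coefficients in
the band coordinate, then `[r] − [b] ∈ KZ.newtonLeibnizRel` (bounds `a = 0 ≤ b = 1` on the point).
[Kontsevich–Zagier 2001, §1.2, rule (3)] [folklore] -/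
theorem pointBase_sub_mem_newtonLeibnizRel (r : IntegralRep 1) (b : IntegralRep 0) {F f : ℝ → ℝ}
    (p : MvPolynomial (Fin 1) ℚ) (hpF : ∀ z : Fin 1 → ℝ, aeval z p = F (z (Fin.last 0)))
    (hF : Continuous F) (hFf : ∀ t, HasDerivAt F (f t) t)
    (hrd : r.domain = {z : Fin 1 → ℝ | 0 ≤ z 0 ∧ z 0 ≤ 1})
    (hri : ∀ z, r.integrand z = f (z (Fin.last 0))) (hbd : b.domain = univ)
    (hbi : ∀ x, b.integrand x = F 1 - F 0) : of r - of b ∈ newtonLeibnizRel := by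
  refine ⟨0, r, b, fun _ => 0, fun _ => 1, fun z => F (z (Fin.last 0)), ?_, ?_, ?_,
    fun _ _ => zero_le_one, ?_, ?_, ?_, ?_, rfl⟩
  · exact (isSemialgebraicFunOn_aeval r.isSemialgebraic_domain p).congr fun z _ => hpF z
  · simpa using isSemialgebraicFunOn_aeval b.isSemialgebraic_domain (0 : MvPolynomial (Fin 0) ℚ)
  · simpa using isSemialgebraicFunOn_aeval b.isSemialgebraic_domain (1 : MvPolynomial (Fin 0) ℚ)
  · rw [hrd, hbd]
    ext z
    simp [Fin.last_zero]
  · intro x _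
    simp only [Fin.snoc_last]
    exact hF.continuousOn
  · intro x _ t _
    simp only [Fin.snoc_last, hri]
    exact hFf t
  · intro x _
    simp only [Fin.snoc_last, hbi]

/-- **Bands over the point are dominated families.** Read over the parameter `s = z 0` (fibres of
dimension `0`), a band `R = [[0, 1], f (z 0)]` with `|f| ≤ C` on `[0, 1]` and `f s → c` as
`s → 0⁺` is dominated near `s = 0⁺` by the constant `[pt, C]` with special fibre `[pt, c]`
(`ε = 1`; every slice over `0 < s < 1` is the point). [Lebesgue] [folklore] -/
theorem pointBase_isDominatedFamily (R : IntegralRep 1) (r₀ g : IntegralRep 0) {f : ℝ → ℝ}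
    {c C : ℝ} (hRd : R.domain = {z : Fin 1 → ℝ | 0 ≤ z 0 ∧ z 0 ≤ 1})
    (hRi : ∀ z, R.integrand z = f (z 0)) (hr₀d : r₀.domain = univ) (hr₀i : ∀ x, r₀.integrand x = c)
    (hgd : g.domain = univ) (hgi : ∀ x, g.integrand x = C)
    (hbound : ∀ t : ℝ, 0 ≤ t → t ≤ 1 → |f t| ≤ C) (hlim : Tendsto f (𝓝[>] 0) (𝓝 c)) :
    IsDominatedFamily R r₀ g := by
  refine ⟨⟨1, one_pos, fun z hz _ _ => ⟨by simp [hgd], ?_⟩⟩, ?_, ?_⟩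
  · rw [hRi, hgi]
    rw [hRd] at hz
    exact hbound _ hz.1 hz.2
  · refine Eventually.of_forall fun x => ?_
    filter_upwards [Ioo_mem_nhdsGT (zero_lt_one' ℝ)] with s hs
    simp [hRd, hr₀d, hs.1.le, hs.2.le]
  · refine Eventually.of_forall fun x _ => ?_
    simp only [hRi, hr₀i, Matrix.cons_val_zero]
    exact hlim

/-! ### Tightness (c) -/

/-- **Tightness of the crux design, (c): Newton–Leibniz over a point base breaks SF.** If the
Newton–Leibniz moves `[r] − [r']` with `r : IntegralRep 1` a band over the POINT
`r' : IntegralRep 0` are admitted among the fibred generators, then "special fibres of dominated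
relations are relations" is false. Witness: `G = [R₁] − [R₂]` with `R₁ = [[0, 1], 1]`,
`R₂ = [[0, 1], 2t]`, both Newton–Leibniz-equivalent over the point to `b₀ = [pt, 1]` (primitives
`t`, `t ^ 2`), so `G` lies in the enlarged closure; over `s = z 0` the family `R₁` is dominated with
special fibre `b₀` and `R₂` (integrand `2s → 0`) with special fibre `[pt, 0]`, and
`KZ.eval ([b₀] − [pt, 0]) = 1 ≠ 0`, whereas relations evaluate to `0`
(`KZ.relations_le_ker_eval_holds`). So the restriction of `KZ.fibredNewtonLeibnizRel` to bases of
dimension `≥ 1` (parameter = a base coordinate) is load-bearing.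
[Kontsevich–Zagier 2001, §1.2, rule (3)] [folklore] -/
theorem not_specialFibre_newtonLeibniz_pointBase :
    ¬ ∀ (k : ℕ) (d : Fin k → ℕ) (m : Fin k → ℤ) (R : (i : Fin k) → KZ.IntegralRep (d i + 1))
      (r₀ g : (i : Fin k) → KZ.IntegralRep (d i)), (∀ i, KZ.IsDominatedFamily (R i) (r₀ i) (g i)) →
      (∑ i, m i • KZ.of (R i)) ∈ AddSubgroup.closure (KZ.fibredGenerators ∪
        {c | c ∈ KZ.newtonLeibnizRel ∧ ∃ (r : KZ.IntegralRep 1) (r' : KZ.IntegralRep 0),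
          c = KZ.of r - KZ.of r'}) →
      (∑ i, m i • KZ.of (r₀ i)) ∈ KZ.relations := by
  intro h
  -- the point base `b₀ = [pt, 1]`, the special fibre `z₀ = [pt, 0]` of the second family and its
  -- envelope `g₂ = [pt, 2]`
  obtain ⟨b₀, hb₀d, hb₀i, hb₀v⟩ :
      ∃ r : IntegralRep 0, r.domain = univ ∧ (∀ x, r.integrand x = 1) ∧ r.value = 1 := by
    simpa using pointBase_exists_constRep 1
  obtain ⟨z₀, hz₀d, hz₀i, hz₀v⟩ :
      ∃ r : IntegralRep 0, r.domain = univ ∧ (∀ x, r.integrand x = 0) ∧ r.value = 0 := by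
    simpa using pointBase_exists_constRep 0
  obtain ⟨g₂, hg₂d, hg₂i, -⟩ :
      ∃ r : IntegralRep 0, r.domain = univ ∧ (∀ x, r.integrand x = 2) ∧ r.value = 2 := by
    simpa using pointBase_exists_constRep 2
  -- the two bands over the point, `R₁ = [[0, 1], 1]` and `R₂ = [[0, 1], 2t]`
  obtain ⟨R₁, hR₁d, hR₁i⟩ := pointBase_exists_bandRep (f := fun _ => (1 : ℝ)) continuous_const 1
    (fun z => by simp)
  obtain ⟨R₂, hR₂d, hR₂i⟩ := pointBase_exists_bandRep (f := fun z => 2 * z (Fin.last 0))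
    (by fun_prop) (C 2 * X (Fin.last 0)) (fun z => by simp)
  -- Newton–Leibniz over the point base, primitives `t` and `t ^ 2`
  have hNL₁ : of R₁ - of b₀ ∈ newtonLeibnizRel :=
    pointBase_sub_mem_newtonLeibnizRel R₁ b₀ (F := fun t => t) (f := fun _ => 1) (X (Fin.last 0))
      (fun z => by simp) continuous_id (fun t => hasDerivAt_id' (x := t)) hR₁d
      (fun z => by simp [hR₁i]) hb₀d (fun x => by simp [hb₀i])
  have hNL₂ : of R₂ - of b₀ ∈ newtonLeibnizRel :=
    pointBase_sub_mem_newtonLeibnizRel R₂ b₀ (F := fun t => t ^ 2) (f := fun t => 2 * t)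
      (X (Fin.last 0) ^ 2) (fun z => by simp) (continuous_pow 2)
      (fun t => by simpa using hasDerivAt_pow 2 t) hR₂d (fun z => by simp [hR₂i]) hb₀d
      (fun x => by norm_num [hb₀i])
  -- domination over `s = z 0`: `R₁ → b₀` (envelope `b₀`), `R₂ → z₀` (envelope `g₂`)
  have hdom₁ : IsDominatedFamily R₁ b₀ b₀ :=
    pointBase_isDominatedFamily R₁ b₀ b₀ (f := fun _ => 1) hR₁d (fun z => by simp [hR₁i]) hb₀d
      hb₀i hb₀d hb₀i (fun t _ _ => by simp) tendsto_const_nhds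
  have hdom₂ : IsDominatedFamily R₂ z₀ g₂ :=
    pointBase_isDominatedFamily R₂ z₀ g₂ (f := fun t => 2 * t) hR₂d
      (fun z => by simp [hR₂i, Fin.last_zero]) hz₀d hz₀i hg₂d hg₂i
      (fun t h0 h1 => by
        show |2 * t| ≤ 2
        rw [abs_of_nonneg (by linarith)]
        linarith)
      (tendsto_nhdsWithin_of_tendsto_nhds ((continuous_const_mul (2 : ℝ)).tendsto' 0 0
        (mul_zero 2)))
  -- apply SF to the net `G = [R₁] - [R₂]`
  refine absurd (h 2 (fun _ => 0) ![1, -1] ![R₁, R₂] ![b₀, z₀] ![b₀, g₂]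
    (Fin.forall_fin_two.mpr ⟨hdom₁, hdom₂⟩) ?_) ?_
  · -- `G = ([R₁] - [b₀]) - ([R₂] - [b₀])` lies in the enlarged closure
    have h₁ : of R₁ - of b₀ ∈ AddSubgroup.closure (fibredGenerators ∪
        {c | c ∈ newtonLeibnizRel ∧ ∃ (r : IntegralRep 1) (r' : IntegralRep 0),
          c = of r - of r'}) :=
      AddSubgroup.subset_closure (Or.inr ⟨hNL₁, R₁, b₀, rfl⟩)
    have h₂ : of R₂ - of b₀ ∈ AddSubgroup.closure (fibredGenerators ∪
        {c | c ∈ newtonLeibnizRel ∧ ∃ (r : IntegralRep 1) (r' : IntegralRep 0),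
          c = of r - of r'}) :=
      AddSubgroup.subset_closure (Or.inr ⟨hNL₂, R₂, b₀, rfl⟩)
    convert AddSubgroup.sub_mem _ h₁ h₂ using 1
    simp only [Fin.sum_univ_two, Matrix.cons_val_zero, Matrix.cons_val_one, one_smul, neg_smul]
    abel
  · -- the special-fibre class `[b₀] - [z₀]` has value `1 ≠ 0`
    intro hrel
    have h0 := relations_le_ker_eval_holds hrel
    rw [AddMonoidHom.mem_ker] at h0
    simp [Fin.sum_univ_two, hb₀v, hz₀v] at h0

end Summit.KontsevichZagierPeriods.ValuedFieldSpecialisation
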